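import Summits.HodgeConjecture.HodgeConjecture.Theorems.Ring2WeilCoverageWeilGramLevel15SqrtNegFifteen
import Summits.HodgeConjecture.HodgeConjecture.Theorems.Ring2WeilCoverageWeilGramSign
import HarnessLib

/-!
# Weil-type family coverage — THE LEVEL-`15` NO ROWS FROM VAN GEEMEN'S SIGN: no principal-type form `E_ζ′` on
# `ℤ[ζ₁₅]` is `Φ`-positive on a CM type `Φ` of `ℚ(√−3)`- or `ℚ(√−15)`-signature `(2, 2)`

research route conditional on HC_CM; not a corollary; Q11.4-sentence-2 already refuted in dim ≥ 3.

Ring 2, WEIL-TYPE FAMILY-COVERAGE CENSUS (`HOME/WEIL-FAMILY-COVERAGE.md` `## b01`, block b01.47; owner ring2-b01), part 93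
of the `Ring2WeilCoverage*` series: parts 83/85 computed, for EVERY skew `ζ′` of principal type on `ℤ[ζ₁₅]`
(`IsOfType 1 ζ′ ⊤`), the van Geemen Gram determinant in the real frame `θ^i`: `−144` for `s₃ = 1 + 2ζ⁵` (`ℚ(√−3)`) and
`−3600` for `s₁₅` (`ℚ(√−15)`); part 92 proved `0 < (−1)ⁿ det a` whenever `ζ′` is `Φ`-positive and `Φ` has
`s`-signature `(n, n)` ([vG94 Lemma 5.2 (4)] at CM points).  With `n = 2`: `(−1)²·(−144) < 0`, `(−1)²·(−3600) < 0`, so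

* **`not_pos_of_principal_sqrtNegThree` / `_sqrtNegFifteen`: for every CM type `Φ` of `ℚ(ζ₁₅)` with
  `#{φ ∈ Φ : Im s^φ < 0} = #{φ ∈ Φ : 0 < Im s^φ} = 2` (Weil signature `(2,2)` for `ℚ(s)`) and every skew `ζ′` of
  principal type, `ζ′` is NOT `Φ`-positive** — i.e. the principal CM fourfold `ℂ^Φ/Φ(ℤ[ζ₁₅])` of Weil type carries
  NO `ι`-compatible PRINCIPAL polarisation: the census NO rows `(15, ℚ(√−3))`, `(15, ℚ(√−15))` of b01.46, proved in
  part 75 through unit signatures (`not_exists_principal_fifteen_sqrt_neg_three/_fifteen`, balancedness phrased by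
  the residue set `N_K`), re-proved here through the SIGN of `det H` (balancedness phrased by the `s`-signature; the
  two phrasings agree by part 28's dictionary, not restated).

HONEST FRAMING as parts 82–92: a statement about Shimura's parameters `ζ′` and CM types of `ℚ(ζ₁₅)`; nothing about
Hodge classes, `W_K`, general members or HC; `HC_CM` is used nowhere.  No `def`, no named fact, no `sorry`.

References: [cite: vanGeemen1994HodgeAV, Lemma 5.2 (2)–(4)]; [cite: Shimura1998, §14.3 Prop. 4–5, pp. 103–104]; census
b01.46/b01.47 (seat-derived).
-/

noncomputable section

open Polynomial NumberField Module
open scoped nonZeroDivisors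

namespace Summit.HodgeConjecture.Ring2WeilCoverage.WeilGramLevel15NoPrincipal

open Literature.AlgebraicGeometry.Motives (CMType)
open Literature.NumberTheory.ComplexMultiplication
open Summit.HodgeConjecture.Ring2WeilCoverage.WeilGramCMPoint (exists_real_eq_mul_of_skew)
open Summit.HodgeConjecture.Ring2WeilCoverage.WeilGramLevel15
open Summit.HodgeConjecture.Ring2WeilCoverage.WeilGramLevel15SqrtNegFifteen
open Summit.HodgeConjecture.Ring2WeilCoverage.WeilGramSign (not_pos_of_neg_one_pow_mul_det_nonpos)

variable {K : Type} [Field K] [NumberField K] {ζ : K}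

open scoped Classical in
/-- **NO principal-type `E_ζ′` on `ℤ[ζ₁₅]` is `Φ`-positive on a `ℚ(√−3)`-signature-`(2,2)` CM type** (`s₃ = 1 + 2ζ⁵`):
`det a = −144` for every skew principal-type `ζ′` (part 83), and van Geemen's sign would force `0 < (−1)² det a`
(part 92) — the census NO row `(15, ℚ(√−3))` from a determinant sign.
research route conditional on HC_CM; not a corollary; Q11.4-sentence-2 already refuted in dim ≥ 3. [cite: vanGeemen1994HodgeAV, Lemma 5.2 (4)] [cite: Shimura1998, §14.3 Prop. 4–5, pp. 103–104] -/
theorem not_pos_of_principal_sqrtNegThree [IsCyclotomicExtension {15} ℚ K] [IsCMField K] (hζ : IsPrimitiveRoot ζ 15)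
    (Φ : CMType K)
    (hneg : (Finset.univ.filter fun φ : Φ.1 => (φ.1 (1 + 2 * ζ ^ 5)).im < 0).card = 2)
    (hposc : (Finset.univ.filter fun φ : Φ.1 => 0 < (φ.1 (1 + 2 * ζ ^ 5)).im).card = 2)
    {ζ' : K} (hζ' : IsCMField.complexConj K ζ' = -ζ')
    (hT : CMTypeLattice.IsOfType (1 : (FractionalIdeal (𝓞 K)⁰ K)ˣ) ζ' ⊤) :
    ¬ ∀ φ : Φ.1, 0 < (φ.1 ζ').im := by
  obtain ⟨ωb, hωb⟩ := exists_basis_thetaPow hζ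
  have hs := complexConj_sqrtNegThree hζ
  have hs0 : (1 + 2 * ζ ^ 5 : K) ≠ 0 := fun h => by
    have h2 := sq_sqrtNegThree hζ
    rw [h] at h2
    norm_num at h2
  obtain ⟨γ₀, hγ⟩ := exists_real_eq_mul_of_skew hζ' hs
  set A : Matrix (Fin 4) (Fin 4) ℚ := Matrix.of fun i j => Algebra.trace ℚ K (ζ' * (ωb i : K) *
      IsCMField.complexConj K ((1 + 2 * ζ ^ 5) * (ωb j : K))) with hA
  have hA' : ∀ i j, A i j = Algebra.trace ℚ K (ζ' * (ωb i : K) *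
      IsCMField.complexConj K ((1 + 2 * ζ ^ 5) * (ωb j : K))) := fun i j => rfl
  have hdet := det_realPart_principal_sqrtNegThree hζ hζ' hT (x := fun i => (ωb i : K)) hωb hA'
  have hζ'0 : ζ' ≠ 0 := by
    intro h0
    have hzero : A = 0 := by
      ext i j
      simp [hA, h0]
    rw [hzero, Matrix.det_zero] at hdet
    norm_num at hdet
  exact not_pos_of_neg_one_pow_mul_det_nonpos Φ ωb hζ' hs hs0 hζ'0 hneg hposc (fun i => rfl) hγ hA'
    (by rw [hdet]; norm_num)

open scoped Classical in
/-- **NO principal-type `E_ζ′` on `ℤ[ζ₁₅]` is `Φ`-positive on a `ℚ(√−15)`-signature-`(2,2)` CM type**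
(`s₁₅ = (1 + 2ζ⁵)(1 + 2(ζ³ + ζ¹²))`): `det a = −3600` for every skew principal-type `ζ′` (part 85) against
`0 < (−1)² det a` (part 92) — the census NO row `(15, ℚ(√−15))` from a determinant sign.
research route conditional on HC_CM; not a corollary; Q11.4-sentence-2 already refuted in dim ≥ 3. [cite: vanGeemen1994HodgeAV, Lemma 5.2 (4)] [cite: Shimura1998, §14.3 Prop. 4–5, pp. 103–104] -/
theorem not_pos_of_principal_sqrtNegFifteen [IsCyclotomicExtension {15} ℚ K] [IsCMField K]
    (hζ : IsPrimitiveRoot ζ 15) (Φ : CMType K)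
    (hneg : (Finset.univ.filter fun φ : Φ.1 => (φ.1 ((1 + 2 * ζ ^ 5) * (1 + 2 * (ζ ^ 3 + ζ ^ 12)))).im < 0).card = 2)
    (hposc : (Finset.univ.filter fun φ : Φ.1 => 0 < (φ.1 ((1 + 2 * ζ ^ 5) * (1 + 2 * (ζ ^ 3 + ζ ^ 12)))).im).card = 2)
    {ζ' : K} (hζ' : IsCMField.complexConj K ζ' = -ζ')
    (hT : CMTypeLattice.IsOfType (1 : (FractionalIdeal (𝓞 K)⁰ K)ˣ) ζ' ⊤) :
    ¬ ∀ φ : Φ.1, 0 < (φ.1 ζ').im := by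
  obtain ⟨ωb, hωb⟩ := exists_basis_thetaPow hζ
  have hs := complexConj_sqrtNegFifteen hζ
  have hs0 : ((1 + 2 * ζ ^ 5) * (1 + 2 * (ζ ^ 3 + ζ ^ 12)) : K) ≠ 0 := fun h => by
    have h2 := sq_sqrtNegFifteen hζ
    rw [h] at h2
    norm_num at h2
  obtain ⟨γ₀, hγ⟩ := exists_real_eq_mul_of_skew hζ' hs
  set A : Matrix (Fin 4) (Fin 4) ℚ := Matrix.of fun i j => Algebra.trace ℚ K (ζ' * (ωb i : K) *
      IsCMField.complexConj K (((1 + 2 * ζ ^ 5) * (1 + 2 * (ζ ^ 3 + ζ ^ 12))) * (ωb j : K))) with hA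
  have hA' : ∀ i j, A i j = Algebra.trace ℚ K (ζ' * (ωb i : K) *
      IsCMField.complexConj K (((1 + 2 * ζ ^ 5) * (1 + 2 * (ζ ^ 3 + ζ ^ 12))) * (ωb j : K))) := fun i j => rfl
  have hdet := det_realPart_principal_sqrtNegFifteen hζ hζ' hT (x := fun i => (ωb i : K)) hωb hA'
  have hζ'0 : ζ' ≠ 0 := by
    intro h0
    have hzero : A = 0 := by
      ext i j
      simp [hA, h0]
    rw [hzero, Matrix.det_zero] at hdet
    norm_num at hdet
  exact not_pos_of_neg_one_pow_mul_det_nonpos Φ ωb hζ' hs hs0 hζ'0 hneg hposc (fun i => rfl) hγ hA'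
    (by rw [hdet]; norm_num)

end Summit.HodgeConjecture.Ring2WeilCoverage.WeilGramLevel15NoPrincipal

end
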